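import Literature.Probability.Percolation.StarTriangleMoves
import Mathlib.MeasureTheory.Constructions.UnitInterval
import HarnessLib

/-!
# The star–triangle transformation as a random map driven by a uniform variable

`Literature.Probability.Percolation.StarTriangle` / `StarTriangleCoupling` give the coupling of
Grimmett–Manolescu (AoP 41 (2013), Prop. 2.2, Figure 5; DKKMO arXiv:2012.11672v2 Def. 2.9) as a
*joint law* of the pair (triangle configuration, star configuration). For the transport of open
paths through a *sequence* of star–triangle transformations (GM14 §5.3, §6; GM13 §3) one needs
the transformation as a genuine **random map** `ω ↦ T(ω, U)` with explicit, reusable extra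
randomness, so that the images of a configuration — and of an open path in it — are honest
random variables on one probability space, and properties "for every value of `U`" are
available pathwise. This file provides that layer:

* `selectList`, `volume_selectList`, `volume_selectList_unitInterval` — inverse-CDF selection
  of an outcome of a finite distribution by a uniform variable `U ∈ [0, 1]` and its law;
* `tMap p t u` / `sMap p s u` — the kernels `T` (triangle → star, GM13 Fig. 5) and `S`
  (star → triangle, the reverse conditional `sWeight`) realised by `u`; `compatible_tMap`,
  `compatible_sMap` (connections among the corners preserved **surely**); their laws
  `volume_tMap_eq` (`= kernelWeight`), `volume_sMap_eq` (`= sWeight`), and the coupling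
  identities `map_prodMk_tMap`, `map_sMap_prodMk`: `(t, T(t, U))` and `(S(s, U), s)` both have
  the law `coupling p` when `t ∼ P^△_p`, resp. `s ∼ P^☆_{1-p}`;
* `tMove` / `sMove` — the moves on configurations of an arbitrary index set (background
  untouched, DKKMO Def. 2.9 "for every edge `e` which does not belong to `ABCO`, `ω'_e = ω_e`"),
  their laws `map_tMove : (P_p ⊗ U).map tMove = P_q`, `map_sMove : (P_q ⊗ U).map sMove = P_p`
  (GM13 Prop. 2.2 (a)–(b)), and the sure facts `isRelated_tMove`, `isRelated_sMove`; in a graph,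
  `reachable_tMove_iff`, `reachable_sMove_iff` (GM13 Prop. 2.2 (c)–(d); GM14 §5.2) for every `u`;
* `sMap_eq_ttf_iff`, `sWeight_full_ttf` — the ordering convention of `S`: for the full star, the
  triangle `(true, true, false)` (edges at the corner `2` open, the edge opposite `2` closed) is
  returned **iff** `u < odds p₀ · odds p₁`, the "secondary outcome" probability
  `η_k(n) = p_{π-A} p_{π-B} / (p_A p_B)` of GM14, proof of Lemma 6.6 — so that a single
  comparison of `U` with a constant dominates the growth events of the track exchange.

Proof of the laws: superposition (`prodBernoulli_eq_map_overlay` of `StarTriangleCoupling`),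
exchange of the background and the uniform factor (`map_prod_prod_swap_right`), and the local
coupling identities.

## References

* G. R. Grimmett, I. Manolescu, Ann. Probab. 41 (2013) 2990–3025, arXiv:1105.5535, §2.1
  Proposition 2.2 and Figure 5.
* G. R. Grimmett, I. Manolescu, PTRF 159 (2014) 273–327, arXiv:1204.0505, §5.1–5.3, §6.2.
* H. Duminil-Copin, K. K. Kozlowski, D. Krachun, I. Manolescu, M. Oulamara, arXiv:2012.11672v2,
  §2.6 Definition 2.9.
-/

noncomputable section

namespace Literature.Probability.Percolation

namespace StarTriangle

open MeasureTheory Set Literature.Probability.LatticeModels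

/-! ### Selecting an outcome of a finite distribution with a uniform variable -/

/-- Inverse-CDF selection: walk along the list `(a₁, w₁), (a₂, w₂), …` and return `a_m` for
`u ∈ [w₁ + ⋯ + w_{m-1}, w₁ + ⋯ + w_m)`; the default `d` if `u` exceeds the total weight. [folklore] -/
def selectList {α : Type*} : List (α × ℝ) → α → ℝ → α
  | [], d, _ => d
  | (a, w) :: l, d, u => if u < w then a else selectList l d (u - w)

/-- The selected outcome is the default or one of the listed outcomes. [folklore] -/
theorem selectList_mem {α : Type*} (l : List (α × ℝ)) (d : α) (u : ℝ) :
    selectList l d u = d ∨ selectList l d u ∈ l.map Prod.fst := by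
  induction l generalizing u with
  | nil => exact Or.inl rfl
  | cons x l ih =>
    obtain ⟨a, w⟩ := x
    simp only [selectList, List.map_cons, List.mem_cons]
    split_ifs
    · exact Or.inr (Or.inl rfl)
    · rcases ih (u - w) with h | h
      · exact Or.inl h
      · exact Or.inr (Or.inr h)

/-- Selection is a measurable function of the uniform variable. [folklore] -/
theorem measurable_selectList {α : Type*} [MeasurableSpace α] [MeasurableSingletonClass α]
    (l : List (α × ℝ)) (d : α) : Measurable (selectList l d) := by
  induction l with
  | nil => exact measurable_const
  | cons x l ih =>
    obtain ⟨a, w⟩ := x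
    simp only [selectList]
    exact Measurable.ite measurableSet_Iio measurable_const (ih.comp (measurable_id.sub_const w))

/-- **The law of the selected outcome**: for nonnegative weights, the set of `u ∈ [0, Σ w)`
selecting `a` has Lebesgue measure the total weight of `a` in the list. [folklore] -/
theorem volume_selectList {α : Type*} [DecidableEq α] (l : List (α × ℝ)) (d : α)
    (hl : ∀ x ∈ l, 0 ≤ x.2) (a : α) :
    volume {u : ℝ | 0 ≤ u ∧ u < (l.map Prod.snd).sum ∧ selectList l d u = a} =
      ENNReal.ofReal (((l.filter fun x => x.1 = a).map Prod.snd).sum) := by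
  induction l with
  | nil =>
    have : {u : ℝ | 0 ≤ u ∧ u < (([] : List (α × ℝ)).map Prod.snd).sum ∧ selectList [] d u = a} = ∅ := by
      ext u; simp only [List.map_nil, List.sum_nil, mem_setOf_eq, mem_empty_iff_false, iff_false]
      rintro ⟨h1, h2, -⟩; linarith
    rw [this]; simp
  | cons x l ih =>
    obtain ⟨b, w⟩ := x
    have hw : 0 ≤ w := hl _ (List.mem_cons_self ..)
    have hl' : ∀ x ∈ l, 0 ≤ x.2 := fun x hx => hl x (List.mem_cons_of_mem _ hx)
    have hT : 0 ≤ (l.map Prod.snd).sum :=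
      List.sum_nonneg (by intro x hx; obtain ⟨y, hy, rfl⟩ := List.mem_map.1 hx; exact hl' y hy)
    set T := (l.map Prod.snd).sum with hTdef
    set A : Set ℝ := {v | 0 ≤ v ∧ v < T ∧ selectList l d v = a} with hA
    -- split according to `u < w`
    have hsplit : {u : ℝ | 0 ≤ u ∧ u < (((b, w) :: l).map Prod.snd).sum ∧ selectList ((b, w) :: l) d u = a} =
        ({u | 0 ≤ u ∧ u < w} ∩ {_u | b = a}) ∪ (fun u => u + (-w)) ⁻¹' A := by
      ext u
      simp only [List.map_cons, List.sum_cons, selectList, mem_setOf_eq, mem_union, mem_inter_iff,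
        mem_preimage, hA]
      constructor
      · rintro ⟨h0, h1, h2⟩
        by_cases hu : u < w
        · rw [if_pos hu] at h2; exact Or.inl ⟨⟨h0, hu⟩, h2⟩
        · rw [if_neg hu] at h2
          refine Or.inr ⟨by linarith, by linarith, ?_⟩
          rwa [← sub_eq_add_neg]
      · rintro (⟨⟨h0, hu⟩, hb⟩ | ⟨h0, h1, h2⟩)
        · exact ⟨h0, by linarith, by rw [if_pos hu]; exact hb⟩
        · refine ⟨by linarith, by linarith, ?_⟩
          rw [if_neg (by linarith), sub_eq_add_neg]; exact h2
    have hdisj : Disjoint ({u : ℝ | 0 ≤ u ∧ u < w} ∩ {_u | b = a}) ((fun u => u + (-w)) ⁻¹' A) := by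
      rw [Set.disjoint_left]
      rintro u ⟨⟨-, hu⟩, -⟩ ⟨h0, -, -⟩
      linarith
    have hmeasA : MeasurableSet A := by
      have : A = {v | 0 ≤ v} ∩ {v | v < T} ∩ (selectList l d) ⁻¹' {a} := by
        ext v; simp [hA, and_assoc]
      rw [this]
      letI : MeasurableSpace α := ⊤
      haveI : MeasurableSingletonClass α := ⟨fun _ => trivial⟩
      exact (measurableSet_Ici.inter measurableSet_Iio).inter
        (measurable_selectList l d (measurableSet_singleton a))
    rw [hsplit, measure_union hdisj (hmeasA.preimage (measurable_add_const _)),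
      measure_preimage_add_right, ih hl', List.filter_cons]
    by_cases hba : b = a
    · have h1 : {u : ℝ | 0 ≤ u ∧ u < w} ∩ {_u | b = a} = Ico 0 w := by
        ext u; simp [hba]
      rw [h1, Real.volume_Ico, sub_zero]
      simp only [hba, decide_true, if_true, List.map_cons, List.sum_cons]
      rw [ENNReal.ofReal_add hw]
      exact List.sum_nonneg (by
        intro x hx; obtain ⟨y, hy, rfl⟩ := List.mem_map.1 hx
        exact hl' y (List.mem_of_mem_filter hy))
    · have h1 : {u : ℝ | 0 ≤ u ∧ u < w} ∩ {_u | b = a} = ∅ := by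
        ext u; simp [hba]
      rw [h1, measure_empty, zero_add]
      simp [hba]

/-- **Selection with a uniform variable on `[0, 1]`**: if the weights are nonnegative and add up
to `1`, the probability of selecting `a` is its total weight. [folklore] -/
theorem volume_selectList_unitInterval {α : Type*} [DecidableEq α] (l : List (α × ℝ)) (d : α)
    (hl : ∀ x ∈ l, 0 ≤ x.2) (hsum : (l.map Prod.snd).sum = 1) (a : α) :
    volume {u : unitInterval | selectList l d u = a} =
      ENNReal.ofReal (((l.filter fun x => x.1 = a).map Prod.snd).sum) := by
  rw [unitInterval.volume_apply]
  have himg : Subtype.val '' {u : unitInterval | selectList l d u = a} =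
      {x : ℝ | x ∈ Icc (0 : ℝ) 1 ∧ selectList l d x = a} := by
    ext x
    simp only [mem_image, mem_setOf_eq]
    constructor
    · rintro ⟨u, hu, rfl⟩; exact ⟨u.2, hu⟩
    · rintro ⟨hx, h⟩; exact ⟨⟨x, hx⟩, h, rfl⟩
  rw [himg]
  -- replace `[0, 1]` by `[0, 1)`: they differ by the null set `{1}`
  have hle : {x : ℝ | x ∈ Icc (0 : ℝ) 1 ∧ selectList l d x = a} ⊆
      {u : ℝ | 0 ≤ u ∧ u < (l.map Prod.snd).sum ∧ selectList l d u = a} ∪ {1} := by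
    rintro x ⟨⟨h0, h1⟩, h⟩
    rcases h1.lt_or_eq with h1 | rfl
    · exact Or.inl ⟨h0, by rw [hsum]; exact h1, h⟩
    · exact Or.inr rfl
  have hge : {u : ℝ | 0 ≤ u ∧ u < (l.map Prod.snd).sum ∧ selectList l d u = a} ⊆
      {x : ℝ | x ∈ Icc (0 : ℝ) 1 ∧ selectList l d x = a} := by
    rintro x ⟨h0, h1, h⟩
    exact ⟨⟨h0, by rw [hsum] at h1; exact h1.le⟩, h⟩
  refine le_antisymm ?_ ((volume_selectList l d hl a).symm.trans_le (measure_mono hge))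
  calc volume {x : ℝ | x ∈ Icc (0 : ℝ) 1 ∧ selectList l d x = a}
      ≤ volume ({u : ℝ | 0 ≤ u ∧ u < (l.map Prod.snd).sum ∧ selectList l d u = a} ∪ {1}) :=
        measure_mono hle
    _ ≤ volume {u : ℝ | 0 ≤ u ∧ u < (l.map Prod.snd).sum ∧ selectList l d u = a} + volume ({1} : Set ℝ) :=
        measure_union_le _ _
    _ = _ := by rw [Real.volume_singleton, add_zero, volume_selectList l d hl a]


/-! ### The local star–triangle kernels realised by a uniform variable -/

/-- Local configurations as triples of Booleans (`tripleEquiv`). [folklore] -/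
abbrev Triple : Type := Bool × Bool × Bool

/-- The transition list of the coupling `T` (triangle → star; GM13 Figure 5, DKKMO Def. 2.9):
only the outcomes of positive probability are listed. [cite: arXiv201211672v2, Def 2.9] -/
def tList (p : Fin 3 → ℝ) : Triple → List (Triple × ℝ)
  | (false, false, false) =>
    [((false, false, false), odds p 0 * odds p 1 * odds p 2), ((true, false, false), odds p 1 * odds p 2),
      ((false, true, false), odds p 0 * odds p 2), ((false, false, true), odds p 0 * odds p 1)]
  | (true, false, false) => [((false, true, true), 1)]
  | (false, true, false) => [((true, false, true), 1)]
  | (false, false, true) => [((true, true, false), 1)]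
  | _ => [((true, true, true), 1)]

/-- The deterministic fallback of `T` (used only on the null event `u = 1`): a star
configuration compatible with the triangle configuration. [folklore] -/
def tDefault : Triple → Triple
  | (false, false, false) => (false, false, false)
  | (true, false, false) => (false, true, true)
  | (false, true, false) => (true, false, true)
  | (false, false, true) => (true, true, false)
  | _ => (true, true, true)

/-- **The map `T` driven by a uniform variable**: the star configuration produced from the
triangle configuration `t` and the uniform variable `u`. [cite: GrimmettManolescuAOP2013, Prop 2.2] -/
def tMap (p : Fin 3 → ℝ) (t : Fin 3 → Bool) (u : ℝ) : Fin 3 → Bool :=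
  tripleEquiv.symm (selectList (tList p (tripleEquiv t)) (tDefault (tripleEquiv t)) u)

/-- The weights of the reverse kernel `S` (star → triangle): the conditional law of the triangle
given the star under the coupling, `P^△_p{t} · kernelWeight p t s / P^☆_{1-p}{s}`.
[cite: GrimmettManolescuAOP2013, Prop 2.2] -/
def sWeight (p : Fin 3 → ℝ) (s t : Fin 3 → Bool) : ℝ :=
  weight p t * kernelWeight p t s / weight (fun k => 1 - p k) s

/-- The transition list of `S` (star → triangle). For the full star the four triangle
configurations with at least two open edges are possible; **the first listed outcome is
`(true, true, false)`** — edges opposite the corners `0` and `1` open, the edge opposite `2`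
closed — so that this outcome is selected exactly when `u` is below its conditional probability
(this ordering is used by the growth estimates of the track exchange). [cite: arXiv201211672v2, Def 2.9] -/
def sList (p : Fin 3 → ℝ) : Triple → List (Triple × ℝ)
  | (true, true, true) =>
    [((true, true, false), sWeight p ![true, true, true] ![true, true, false]),
      ((true, false, true), sWeight p ![true, true, true] ![true, false, true]),
      ((false, true, true), sWeight p ![true, true, true] ![false, true, true]),
      ((true, true, true), sWeight p ![true, true, true] ![true, true, true])]
  | (false, true, true) => [((true, false, false), 1)]
  | (true, false, true) => [((false, true, false), 1)]
  | (true, true, false) => [((false, false, true), 1)]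
  | _ => [((false, false, false), 1)]

/-- The deterministic fallback of `S`. [folklore] -/
def sDefault : Triple → Triple
  | (true, true, true) => (true, true, true)
  | (false, true, true) => (true, false, false)
  | (true, false, true) => (false, true, false)
  | (true, true, false) => (false, false, true)
  | _ => (false, false, false)

/-- **The map `S` driven by a uniform variable**: the triangle configuration produced from the
star configuration `s` and the uniform variable `u`. [cite: GrimmettManolescuAOP2013, Prop 2.2] -/
def sMap (p : Fin 3 → ℝ) (s : Fin 3 → Bool) (u : ℝ) : Fin 3 → Bool :=
  tripleEquiv.symm (selectList (sList p (tripleEquiv s)) (sDefault (tripleEquiv s)) u)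

/-- `tripleEquiv` unfolded. [folklore] -/
@[simp] theorem tripleEquiv_apply (t : Fin 3 → Bool) : tripleEquiv t = (t 0, t 1, t 2) := rfl

/-- `tripleEquiv.symm` unfolded. [folklore] -/
@[simp] theorem tripleEquiv_symm_apply (x : Triple) : tripleEquiv.symm x = ![x.1, x.2.1, x.2.2] := rfl

/-- **`T` produces compatible configurations, surely** (GM13 Prop. 2.2: "`x ↔ y` in `ω` iff in
`T(ω)`"). [cite: GrimmettManolescuAOP2013, Prop 2.2] -/
theorem compatible_tMap (p : Fin 3 → ℝ) (t : Fin 3 → Bool) (u : ℝ) : Compatible t (tMap p t u) := by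
  have hmem := selectList_mem (tList p (tripleEquiv t)) (tDefault (tripleEquiv t)) u
  unfold tMap
  generalize selectList (tList p (tripleEquiv t)) (tDefault (tripleEquiv t)) u = x at hmem
  obtain ⟨a, b, c, rfl⟩ : ∃ a b c, t = ![a, b, c] := ⟨t 0, t 1, t 2, eq_vec t⟩
  obtain ⟨x1, x2, x3⟩ := x
  cases a <;> cases b <;> cases c <;> cases x1 <;> cases x2 <;> cases x3 <;>
    simp [tList, tDefault] at hmem <;> decide

/-- **`S` produces compatible configurations, surely.** [cite: GrimmettManolescuAOP2013, Prop 2.2] -/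
theorem compatible_sMap (p : Fin 3 → ℝ) (s : Fin 3 → Bool) (u : ℝ) : Compatible (sMap p s u) s := by
  have hmem := selectList_mem (sList p (tripleEquiv s)) (sDefault (tripleEquiv s)) u
  unfold sMap
  generalize selectList (sList p (tripleEquiv s)) (sDefault (tripleEquiv s)) u = x at hmem
  obtain ⟨a, b, c, rfl⟩ : ∃ a b c, s = ![a, b, c] := ⟨s 0, s 1, s 2, eq_vec s⟩
  obtain ⟨x1, x2, x3⟩ := x
  cases a <;> cases b <;> cases c <;> cases x1 <;> cases x2 <;> cases x3 <;>
    simp [sList, sDefault] at hmem <;> decide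


/-! ### The laws of `T` and `S` -/

section Laws

variable {p : Fin 3 → ℝ}

/-- The weights of `tList` are nonnegative for `p ∈ [0, 1)³`. [folklore] -/
theorem tList_nonneg (hp : ∀ k, p k ∈ Set.Ico (0 : ℝ) 1) (x : Triple) : ∀ y ∈ tList p x, 0 ≤ y.2 := by
  have ho : ∀ k, 0 ≤ odds p k := fun k => div_nonneg (hp k).1 (by linarith [(hp k).2])
  obtain ⟨a, b, c⟩ := x
  cases a <;> cases b <;> cases c <;> simp [tList]
  exact ⟨mul_nonneg (mul_nonneg (ho 0) (ho 1)) (ho 2), mul_nonneg (ho 1) (ho 2), mul_nonneg (ho 0) (ho 2),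
    mul_nonneg (ho 0) (ho 1)⟩

/-- The weights of `tList` add up to `1` (self-duality). [cite: GrimmettManolescuAOP2013, Fig. 5] -/
theorem tList_sum (hp : ∀ k, p k ∈ Set.Ico (0 : ℝ) 1) (hκ : kappa p = 0) (x : Triple) :
    ((tList p x).map Prod.snd).sum = 1 := by
  obtain ⟨a, b, c⟩ := x
  have h := sum_kernelWeight hp hκ ![false, false, false]
  rw [sum_eq] at h
  cases a <;> cases b <;> cases c <;> simp [tList]
  simp [kernelWeight] at h
  linarith

/-- The total weight of the star configuration `s` in `tList p t` is `kernelWeight p t s`.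
[cite: arXiv201211672v2, Def 2.9] -/
theorem tList_filter_sum (t s : Fin 3 → Bool) :
    (((tList p (tripleEquiv t)).filter fun y => y.1 = tripleEquiv s).map Prod.snd).sum = kernelWeight p t s := by
  obtain ⟨a, b, c, rfl⟩ : ∃ a b c, t = ![a, b, c] := ⟨t 0, t 1, t 2, eq_vec t⟩
  obtain ⟨x, y, z, rfl⟩ : ∃ x y z, s = ![x, y, z] := ⟨s 0, s 1, s 2, eq_vec s⟩
  cases a <;> cases b <;> cases c <;> cases x <;> cases y <;> cases z <;> simp [tList, kernelWeight]

/-- **The law of `T`**: `P(T(t, U) = s) = kernelWeight p t s` for `U` uniform on `[0, 1]`.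
[cite: GrimmettManolescuAOP2013, Prop 2.2] -/
theorem volume_tMap_eq (hp : ∀ k, p k ∈ Set.Ico (0 : ℝ) 1) (hκ : kappa p = 0) (t s : Fin 3 → Bool) :
    volume {u : unitInterval | tMap p t u = s} = ENNReal.ofReal (kernelWeight p t s) := by
  have hset : {u : unitInterval | tMap p t u = s} =
      {u : unitInterval | selectList (tList p (tripleEquiv t)) (tDefault (tripleEquiv t)) u = tripleEquiv s} := by
    ext u
    simp only [Set.mem_setOf_eq, tMap]
    rw [Equiv.symm_apply_eq]
  rw [hset, volume_selectList_unitInterval _ _ (tList_nonneg hp _) (tList_sum hp hκ _), tList_filter_sum]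

/-- `sWeight` is nonnegative. [folklore] -/
theorem sWeight_nonneg (hp : ∀ k, p k ∈ Set.Ioo (0 : ℝ) 1) (s t : Fin 3 → Bool) : 0 ≤ sWeight p s t := by
  have hp' : ∀ k, p k ∈ Set.Icc (0 : ℝ) 1 := fun k => ⟨(hp k).1.le, (hp k).2.le⟩
  have hq' : ∀ k, 1 - p k ∈ Set.Icc (0 : ℝ) 1 := fun k => ⟨by linarith [(hp k).2], by linarith [(hp k).1]⟩
  have hp'' : ∀ k, p k ∈ Set.Ico (0 : ℝ) 1 := fun k => ⟨(hp k).1.le, (hp k).2⟩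
  exact div_nonneg (mul_nonneg (weight_nonneg hp' t) (kernelWeight_nonneg hp'' t s)) (weight_nonneg hq' s)

/-- The weights of `sList` are nonnegative for `p ∈ (0, 1)³`. [folklore] -/
theorem sList_nonneg (hp : ∀ k, p k ∈ Set.Ioo (0 : ℝ) 1) (x : Triple) : ∀ y ∈ sList p x, 0 ≤ y.2 := by
  obtain ⟨a, b, c⟩ := x
  cases a <;> cases b <;> cases c <;> simp [sList]
  exact ⟨sWeight_nonneg hp _ _, sWeight_nonneg hp _ _, sWeight_nonneg hp _ _, sWeight_nonneg hp _ _⟩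

/-- The star weight `P^☆_{1-p}{s}` is positive for `p ∈ (0, 1)³`. [folklore] -/
theorem weight_compl_pos (hp : ∀ k, p k ∈ Set.Ioo (0 : ℝ) 1) (s : Fin 3 → Bool) :
    0 < weight (fun k => 1 - p k) s := by
  unfold weight
  refine Finset.prod_pos fun k _ => ?_
  split_ifs
  · linarith [(hp k).2]
  · linarith [(hp k).1]

/-- The total weight of the triangle configuration `t` in `sList p s` is `sWeight p s t`.
[cite: GrimmettManolescuAOP2013, Prop 2.2] -/
theorem sList_filter_sum (hp : ∀ k, p k ∈ Set.Ioo (0 : ℝ) 1) (s t : Fin 3 → Bool) :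
    (((sList p (tripleEquiv s)).filter fun y => y.1 = tripleEquiv t).map Prod.snd).sum = sWeight p s t := by
  have h0 : p 0 ≠ 0 := (hp 0).1.ne'
  have h1 : p 1 ≠ 0 := (hp 1).1.ne'
  have h2 : p 2 ≠ 0 := (hp 2).1.ne'
  have h0' : 1 - p 0 ≠ 0 := by linarith [(hp 0).2]
  have h1' : 1 - p 1 ≠ 0 := by linarith [(hp 1).2]
  have h2' : 1 - p 2 ≠ 0 := by linarith [(hp 2).2]
  obtain ⟨a, b, c, rfl⟩ : ∃ a b c, s = ![a, b, c] := ⟨s 0, s 1, s 2, eq_vec s⟩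
  obtain ⟨x, y, z, rfl⟩ : ∃ x y z, t = ![x, y, z] := ⟨t 0, t 1, t 2, eq_vec t⟩
  cases a <;> cases b <;> cases c <;> cases x <;> cases y <;> cases z <;>
    simp [sList, sWeight, kernelWeight, weight, Fin.prod_univ_three, odds] <;> field_simp

/-- The weights of `sList` add up to `1` (self-duality, through the second marginal of the
coupling). [cite: GrimmettManolescuAOP2013, Prop 2.2] -/
theorem sList_sum (hp : ∀ k, p k ∈ Set.Ioo (0 : ℝ) 1) (hκ : kappa p = 0) (s : Fin 3 → Bool) :
    ((sList p (tripleEquiv s)).map Prod.snd).sum = 1 := by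
  have hp'' : ∀ k, p k ∈ Set.Ico (0 : ℝ) 1 := fun k => ⟨(hp k).1.le, (hp k).2⟩
  have hne := (weight_compl_pos hp s).ne'
  have hsum : ∑ t, sWeight p s t = 1 := by
    unfold sWeight
    rw [← Finset.sum_div, sum_weight_mul_kernelWeight hp'' hκ s, div_self hne]
  rw [sum_eq] at hsum
  obtain ⟨a, b, c, rfl⟩ : ∃ a b c, s = ![a, b, c] := ⟨s 0, s 1, s 2, eq_vec s⟩
  -- the unlisted configurations have weight `0`
  have hz : ∀ t, kernelWeight p t ![a, b, c] = 0 → sWeight p ![a, b, c] t = 0 := by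
    intro t ht; simp [sWeight, ht]
  cases a <;> cases b <;> cases c <;> simp [sList]
  simp [hz, kernelWeight] at hsum
  linarith

/-- **The law of `S`**: `P(S(s, U) = t) = sWeight p s t` for `U` uniform on `[0, 1]`.
[cite: GrimmettManolescuAOP2013, Prop 2.2] -/
theorem volume_sMap_eq (hp : ∀ k, p k ∈ Set.Ioo (0 : ℝ) 1) (hκ : kappa p = 0) (s t : Fin 3 → Bool) :
    volume {u : unitInterval | sMap p s u = t} = ENNReal.ofReal (sWeight p s t) := by
  have hset : {u : unitInterval | sMap p s u = t} =
      {u : unitInterval | selectList (sList p (tripleEquiv s)) (sDefault (tripleEquiv s)) u = tripleEquiv t} := by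
    ext u
    simp only [Set.mem_setOf_eq, sMap]
    rw [Equiv.symm_apply_eq]
  rw [hset, volume_selectList_unitInterval _ _ (sList_nonneg hp _) (sList_sum hp hκ _), sList_filter_sum hp]

end Laws


/-! ### The coupling realised -/

section Coupling

variable {p : Fin 3 → ℝ}

/-- The mass of a point under the coupling. [folklore] -/
theorem coupling_singleton (p : Fin 3 → ℝ) (t₀ s₀ : Fin 3 → Bool) :
    coupling p {(t₀, s₀)} = ENNReal.ofReal (weight p t₀ * kernelWeight p t₀ s₀) := by
  rw [coupling_apply, Finset.sum_eq_single t₀, Finset.sum_eq_single s₀]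
  · simp
  · intro s _ hs
    simp [hs]
  · simp
  · intro t _ ht
    refine Finset.sum_eq_zero fun s _ => ?_
    simp [ht]
  · simp

/-- `T` is a measurable function of the uniform variable. [folklore] -/
theorem measurable_tMap (p : Fin 3 → ℝ) (t : Fin 3 → Bool) : Measurable fun u : unitInterval => tMap p t u :=
  (Measurable.of_discrete (f := (tripleEquiv.symm : Triple → Fin 3 → Bool))).comp
    ((measurable_selectList _ _).comp measurable_subtype_coe)

/-- `S` is a measurable function of the uniform variable. [folklore] -/
theorem measurable_sMap (p : Fin 3 → ℝ) (s : Fin 3 → Bool) : Measurable fun u : unitInterval => sMap p s u :=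
  (Measurable.of_discrete (f := (tripleEquiv.symm : Triple → Fin 3 → Bool))).comp
    ((measurable_selectList _ _).comp measurable_subtype_coe)

/-- The joint map `(t, u) ↦ (t, T(t, u))` is measurable. [folklore] -/
theorem measurable_prodMk_tMap (p : Fin 3 → ℝ) :
    Measurable fun x : (Fin 3 → Bool) × unitInterval => (x.1, tMap p x.1 x.2) :=
  measurable_from_prod_countable_right fun t => measurable_const.prodMk (measurable_tMap p t)

/-- The joint map `(s, u) ↦ (S(s, u), s)` is measurable. [folklore] -/
theorem measurable_sMap_prodMk (p : Fin 3 → ℝ) :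
    Measurable fun x : (Fin 3 → Bool) × unitInterval => (sMap p x.1 x.2, x.1) :=
  measurable_from_prod_countable_right fun s => (measurable_sMap p s).prodMk measurable_const

/-- **The coupling `T` realised by a uniform variable**: if `t ∼ P^△_p` and `U` is an
independent uniform variable, then `(t, T(t, U))` has the law of the star–triangle coupling of
`StarTriangle` (GM13 Prop. 2.2 / DKKMO Def. 2.9, now as a random *map*).
[cite: GrimmettManolescuAOP2013, Prop 2.2] -/
theorem map_prodMk_tMap (hp : ∀ k, p k ∈ Set.Ico (0 : ℝ) 1) (hκ : kappa p = 0) :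
    ((law p).prod (volume : Measure unitInterval)).map
        (fun x : (Fin 3 → Bool) × unitInterval => (x.1, tMap p x.1 x.2)) = coupling p := by
  have hp' : ∀ k, p k ∈ Set.Icc (0 : ℝ) 1 := fun k => ⟨(hp k).1, (hp k).2.le⟩
  haveI := isProbabilityMeasure_law hp'
  refine Measure.ext_iff_singleton.2 fun x => ?_
  obtain ⟨t₀, s₀⟩ := x
  rw [Measure.map_apply (measurable_prodMk_tMap p) (measurableSet_singleton _), coupling_singleton]
  have hpre : (fun x : (Fin 3 → Bool) × unitInterval => (x.1, tMap p x.1 x.2)) ⁻¹' {(t₀, s₀)} =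
      ({t₀} : Set (Fin 3 → Bool)) ×ˢ {u : unitInterval | tMap p t₀ u = s₀} := by
    ext ⟨t, u⟩
    simp only [Set.mem_preimage, Set.mem_singleton_iff, Prod.mk.injEq, Set.mem_prod, Set.mem_setOf_eq]
    constructor
    · rintro ⟨rfl, h⟩; exact ⟨rfl, h⟩
    · rintro ⟨rfl, h⟩; exact ⟨rfl, h⟩
  rw [hpre, Measure.prod_prod, law_singleton hp', volume_tMap_eq hp hκ,
    ENNReal.ofReal_mul (weight_nonneg hp' _)]

/-- **The reverse coupling `S` realised by a uniform variable**: if `s ∼ P^☆_{1-p}` and `U` is an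
independent uniform variable, then `(S(s, U), s)` has the law of the star–triangle coupling.
[cite: GrimmettManolescuAOP2013, Prop 2.2] -/
theorem map_sMap_prodMk (hp : ∀ k, p k ∈ Set.Ioo (0 : ℝ) 1) (hκ : kappa p = 0) :
    ((law fun k => 1 - p k).prod (volume : Measure unitInterval)).map
        (fun x : (Fin 3 → Bool) × unitInterval => (sMap p x.1 x.2, x.1)) = coupling p := by
  have hp' : ∀ k, p k ∈ Set.Icc (0 : ℝ) 1 := fun k => ⟨(hp k).1.le, (hp k).2.le⟩
  have hq' : ∀ k, 1 - p k ∈ Set.Icc (0 : ℝ) 1 := fun k => ⟨by linarith [(hp k).2], by linarith [(hp k).1]⟩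
  haveI := isProbabilityMeasure_law hq'
  refine Measure.ext_iff_singleton.2 fun x => ?_
  obtain ⟨t₀, s₀⟩ := x
  rw [Measure.map_apply (measurable_sMap_prodMk p) (measurableSet_singleton _), coupling_singleton]
  have hpre : (fun x : (Fin 3 → Bool) × unitInterval => (sMap p x.1 x.2, x.1)) ⁻¹' {(t₀, s₀)} =
      ({s₀} : Set (Fin 3 → Bool)) ×ˢ {u : unitInterval | sMap p s₀ u = t₀} := by
    ext ⟨s, u⟩
    simp only [Set.mem_preimage, Set.mem_singleton_iff, Prod.mk.injEq, Set.mem_prod, Set.mem_setOf_eq]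
    constructor
    · rintro ⟨h, rfl⟩; exact ⟨rfl, h⟩
    · rintro ⟨rfl, h⟩; exact ⟨h, rfl⟩
  rw [hpre, Measure.prod_prod, law_singleton hq', volume_sMap_eq hp hκ,
    ← ENNReal.ofReal_mul (weight_nonneg hq' _), sWeight, mul_div_cancel₀ _ (weight_compl_pos hp s₀).ne']

end Coupling


/-! ### The moves on configurations, driven by a uniform variable -/

section Moves

variable {ι : Type*}

/-- Exchanging the last two factors of a triple product of s-finite measures. [folklore] -/
theorem map_prod_prod_swap_right {α β γ : Type*} [MeasurableSpace α] [MeasurableSpace β] [MeasurableSpace γ]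
    (μ : Measure α) (ν : Measure β) (τ : Measure γ) [SFinite μ] [SFinite ν] [SFinite τ] :
    ((μ.prod ν).prod τ).map (fun x : (α × β) × γ => ((x.1.1, x.2), x.1.2)) = (μ.prod τ).prod ν := by
  have hψ : (fun x : (α × β) × γ => ((x.1.1, x.2), x.1.2)) =
      ((MeasurableEquiv.prodAssoc.symm : α × γ × β ≃ᵐ (α × γ) × β) ∘ Prod.map id Prod.swap) ∘
        (MeasurableEquiv.prodAssoc : (α × β) × γ ≃ᵐ _) := by
    funext x; rfl
  have hm : Measurable ((MeasurableEquiv.prodAssoc.symm : α × γ × β ≃ᵐ (α × γ) × β) ∘ Prod.map id Prod.swap) :=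
    MeasurableEquiv.prodAssoc.symm.measurable.comp (measurable_id.prodMap measurable_swap)
  rw [hψ, ← Measure.map_map hm MeasurableEquiv.prodAssoc.measurable, Measure.prodAssoc_prod,
    ← Measure.map_map MeasurableEquiv.prodAssoc.symm.measurable (measurable_id.prodMap measurable_swap),
    ← Measure.map_prod_map μ (ν.prod τ) measurable_id measurable_swap, Measure.map_id, Measure.prod_swap,
    ← Measure.prodAssoc_prod (μ := μ) (ν := τ) (τ := ν), MeasurableEquiv.map_symm_map]

open Classical in
/-- The local state of the three coordinates `e k` in the configuration `ω`. [folklore] -/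
def readLocal (e : Fin 3 → ι) (ω : Set ι) : Fin 3 → Bool := fun k => decide (e k ∈ ω)

/-- `readLocal` is measurable. [folklore] -/
theorem measurable_readLocal (e : Fin 3 → ι) : Measurable (readLocal e) := by
  refine measurable_pi_lambda _ fun k => ?_
  exact (Measurable.of_discrete (f := fun P : Prop => @decide P (Classical.propDecidable P))).comp
    (measurable_set_mem (e k))

/-- Reading the local state of an overlaid configuration gives back the local configuration,
when the background is free of the three coordinates. [folklore] -/
theorem readLocal_overlay {e : Fin 3 → ι} (he : Function.Injective e) (ξ : Fin 3 → Bool) {ρ : Set ι}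
    (hρ : ∀ k, e k ∉ ρ) : readLocal e (overlay e (ξ, ρ)) = ξ := by
  classical
  unfold readLocal
  convert decide_mem_overlay_eq he (ξ := ξ) hρ using 1

/-- Removing the three coordinates from an overlaid configuration gives back the background,
when the background is free of them. [folklore] -/
theorem overlay_diff_range (e : Fin 3 → ι) (ξ : Fin 3 → Bool) {ρ : Set ι} (hρ : ∀ k, e k ∉ ρ) :
    overlay e (ξ, ρ) \ Set.range e = ρ := by
  ext i
  rw [Set.mem_sdiff, mem_overlay_iff, Set.mem_range, not_exists]
  constructor
  · rintro ⟨h | ⟨k, -, rfl⟩, hne⟩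
    · exact h
    · exact absurd rfl (hne k)
  · intro hi
    exact ⟨Or.inl hi, fun k hk => hρ k (hk ▸ hi)⟩

variable (p : ι → unitInterval) (eT eS : Fin 3 → ι)

/-- The local parameters of the triangle, as reals. [folklore] -/
def triParam : Fin 3 → ℝ := fun k => (p (eT k) : ℝ)

/-- **The triangle → star move driven by a uniform variable**: read the triangle state, remove
the triangle coordinates, lay down the star produced by `T`. (GM13 Prop. 2.2 `T : Ω → Ω'`;
DKKMO Def. 2.9: "for every edge `e` which does not belong to `ABCO`, `ω'_e = ω_e`".)
[cite: GrimmettManolescuAOP2013, Prop 2.2] -/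
def tMove (ω : Set ι) (u : unitInterval) : Set ι :=
  overlay eS (tMap (triParam p eT) (readLocal eT ω) u, ω \ Set.range eT)

/-- **The star → triangle move driven by a uniform variable** (GM13 Prop. 2.2 `S : Ω' → Ω`).
[cite: GrimmettManolescuAOP2013, Prop 2.2] -/
def sMove (ω : Set ι) (u : unitInterval) : Set ι :=
  overlay eT (sMap (triParam p eT) (readLocal eS ω) u, ω \ Set.range eS)

variable {p eT eS}

/-- The triangle → star move is jointly measurable. [folklore] -/
theorem measurable_tMove : Measurable fun x : Set ι × unitInterval => tMove p eT eS x.1 x.2 := by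
  unfold tMove
  refine (measurable_overlay eS).comp (Measurable.prodMk ?_ ?_)
  · have h : Measurable fun y : (Fin 3 → Bool) × unitInterval => tMap (triParam p eT) y.1 y.2 :=
      measurable_from_prod_countable_right fun t => measurable_tMap _ t
    exact h.comp ((measurable_readLocal eT).comp measurable_fst |>.prodMk measurable_snd)
  · exact (measurable_sdiff_const _).comp measurable_fst

/-- The star → triangle move is jointly measurable. [folklore] -/
theorem measurable_sMove : Measurable fun x : Set ι × unitInterval => sMove p eT eS x.1 x.2 := by
  unfold sMove
  refine (measurable_overlay eT).comp (Measurable.prodMk ?_ ?_)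
  · have h : Measurable fun y : (Fin 3 → Bool) × unitInterval => sMap (triParam p eT) y.1 y.2 :=
      measurable_from_prod_countable_right fun s => measurable_sMap _ s
    exact h.comp ((measurable_readLocal eS).comp measurable_fst |>.prodMk measurable_snd)
  · exact (measurable_sdiff_const _).comp measurable_fst


/-! #### The laws of the moves -/

/-- Under `P_{p⁰}` with the three coordinates switched off, the background is a.s. free of
them. [folklore] -/
theorem prodBernoulli_setOf_exists_mem_eq_zero (p0 : ι → unitInterval) (e : Fin 3 → ι)
    (h0 : ∀ k, p0 (e k) = 0) : prodBernoulli p0 {ρ | ∃ k, e k ∈ ρ} = 0 := by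
  have hN' : {ρ : Set ι | ∃ k, e k ∈ ρ} = ⋃ k, {ρ : Set ι | e k ∈ ρ} := by ext ρ; simp
  rw [hN', measure_iUnion_null_iff]
  intro k
  have h := prodBernoulli_real_setOf_mem p0 (e k)
  rw [h0 k] at h
  have h' : (prodBernoulli p0).real {ρ : Set ι | e k ∈ ρ} = 0 := by simpa using h
  exact (measureReal_eq_zero_iff (measure_ne_top _ _)).1 h'

/-- **The law of the triangle → star move.** If `ω ∼ P_p` (triangle on, star off) and `U` is an
independent uniform variable, then `tMove ω U ∼ P_q`, where `q` switches the triangle off, puts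
`1 - p (eT k)` on the star coordinate `eS k` and agrees with `p` elsewhere (GM13 Prop. 2.2(a):
"`T(ω)` has the same law as `ω'`"). [cite: GrimmettManolescuAOP2013, Prop 2.2] -/
theorem map_tMove (heT : Function.Injective eT) (heS : Function.Injective eS)
    (hTS : ∀ j k, eS k ≠ eT j) (hpS : ∀ k, p (eS k) = 0) {q : ι → unitInterval}
    (hqT : ∀ k, q (eT k) = 0) (hqS : ∀ k, (q (eS k) : ℝ) = 1 - p (eT k))
    (hpq : ∀ i, (∀ k, i ≠ eT k) → (∀ k, i ≠ eS k) → q i = p i)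
    (hκ : kappa (triParam p eT) = 0) (hlt : ∀ k, (p (eT k) : ℝ) < 1) :
    ((prodBernoulli p).prod (volume : Measure unitInterval)).map
        (fun x : Set ι × unitInterval => tMove p eT eS x.1 x.2) = prodBernoulli q := by
  -- notation and instances
  set r : Fin 3 → ℝ := triParam p eT with hr
  have hp01 : ∀ k, r k ∈ Set.Ico (0 : ℝ) 1 := fun k => ⟨(p (eT k)).2.1, hlt k⟩
  have hp' : ∀ k, r k ∈ Set.Icc (0 : ℝ) 1 := fun k => ⟨(hp01 k).1, (hp01 k).2.le⟩
  have hq' : ∀ k, 1 - r k ∈ Set.Icc (0 : ℝ) 1 := fun k => ⟨by linarith [(hp01 k).2], by linarith [(hp01 k).1]⟩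
  haveI := isProbabilityMeasure_law hp'
  haveI := isProbabilityMeasure_law hq'
  haveI := isProbabilityMeasure_coupling hp01 hκ
  set P0 : Measure (Set ι) := prodBernoulli (bgParam p eT) with hP0
  -- Step 1: superposition for `P_p`
  have hP : prodBernoulli p = ((law r).prod P0).map (overlay eT) :=
    prodBernoulli_eq_map_overlay heT (bgParam p eT) p (fun k => p (eT k)) (bgParam_apply_eT p eT)
      (fun _ => rfl) (fun i hi => (bgParam_apply_of_ne p eT hi).symm)
  -- Step 2: pull the overlay through the product with the uniform variable
  have h2 : (((law r).prod P0).map (overlay eT)).prod (volume : Measure unitInterval) =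
      (((law r).prod P0).prod (volume : Measure unitInterval)).map (Prod.map (overlay eT) id) := by
    rw [← Measure.map_prod_map _ _ (measurable_overlay eT) measurable_id, Measure.map_id]
  rw [hP, h2, Measure.map_map measurable_tMove ((measurable_overlay eT).prodMap measurable_id)]
  -- Step 3: on a set of full measure the composite is the overlay of `T`
  set G : ((Fin 3 → Bool) × Set ι) × unitInterval → Set ι :=
    fun x => overlay eS (tMap r x.1.1 x.2, x.1.2) with hG
  have hae : (fun x : Set ι × unitInterval => tMove p eT eS x.1 x.2) ∘ Prod.map (overlay eT) id
      =ᵐ[((law r).prod P0).prod (volume : Measure unitInterval)] G := by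
    have hnull : (((law r).prod P0).prod (volume : Measure unitInterval))
        {x | ∃ k, eT k ∈ x.1.2} = 0 := by
      have hset : {x : ((Fin 3 → Bool) × Set ι) × unitInterval | ∃ k, eT k ∈ x.1.2} =
          ((Set.univ : Set (Fin 3 → Bool)) ×ˢ {ρ : Set ι | ∃ k, eT k ∈ ρ}) ×ˢ (Set.univ : Set unitInterval) := by
        ext x; simp
      rw [hset, Measure.prod_prod, Measure.prod_prod,
        prodBernoulli_setOf_exists_mem_eq_zero _ _ (bgParam_apply_eT p eT), mul_zero, zero_mul]
    refine Filter.eventuallyEq_of_mem (s := {x | ∃ k, eT k ∈ x.1.2}ᶜ) (compl_mem_ae_iff.2 hnull) ?_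
    rintro ⟨⟨t, ρ⟩, u⟩ hx
    simp only [Set.mem_compl_iff, Set.mem_setOf_eq, not_exists] at hx
    simp only [Function.comp_apply, Prod.map_apply, id_eq, hG, tMove]
    rw [readLocal_overlay heT t hx, overlay_diff_range eT t hx]
  rw [Measure.map_congr hae]
  -- Step 4: reorder the factors and push `T` through
  have hGeq : G = (overlay eS ∘ Prod.map (fun y : (Fin 3 → Bool) × unitInterval => tMap r y.1 y.2) id) ∘
      fun x : ((Fin 3 → Bool) × Set ι) × unitInterval => ((x.1.1, x.2), x.1.2) := by
    funext x; rfl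
  have hF : Measurable fun y : (Fin 3 → Bool) × unitInterval => tMap r y.1 y.2 :=
    measurable_from_prod_countable_right fun t => measurable_tMap _ t
  have hψ : Measurable fun x : ((Fin 3 → Bool) × Set ι) × unitInterval => ((x.1.1, x.2), x.1.2) :=
    (measurable_fst.fst.prodMk measurable_snd).prodMk measurable_fst.snd
  rw [hGeq, ← Measure.map_map ((measurable_overlay eS).comp (hF.prodMap measurable_id)) hψ,
    map_prod_prod_swap_right, ← Measure.map_map (measurable_overlay eS) (hF.prodMap measurable_id),
    ← Measure.map_prod_map _ _ hF measurable_id, Measure.map_id]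
  -- Step 5: the law of `T`
  have hT : ((law r).prod (volume : Measure unitInterval)).map
      (fun y : (Fin 3 → Bool) × unitInterval => tMap r y.1 y.2) = law (fun k => 1 - r k) := by
    have : (fun y : (Fin 3 → Bool) × unitInterval => tMap r y.1 y.2) =
        Prod.snd ∘ fun y : (Fin 3 → Bool) × unitInterval => (y.1, tMap r y.1 y.2) := by
      funext y; rfl
    rw [this, ← Measure.map_map measurable_snd (measurable_prodMk_tMap r), map_prodMk_tMap hp01 hκ,
      map_snd_coupling hp01 hκ]
  rw [hT]
  -- Step 6: superposition for `P_q`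
  have hlaw : law (fun k => 1 - r k) = law (fun k => ((q (eS k) : unitInterval) : ℝ)) := by
    congr 1; funext k; rw [hqS k]; rfl
  rw [hlaw]
  refine (prodBernoulli_eq_map_overlay heS (bgParam p eT) q (fun k => q (eS k)) (fun k => ?_) (fun _ => rfl)
    (fun i hi => ?_)).symm
  · rw [bgParam_apply_of_ne p eT (fun j => hTS j k)]
    exact hpS k
  · by_cases hT : ∃ k, i = eT k
    · obtain ⟨k, rfl⟩ := hT
      rw [hqT, bgParam_apply_eT]
    · push Not at hT
      rw [hpq i hT hi, bgParam_apply_of_ne p eT hT]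


/-- The background of `P_q` with the star switched off equals the background of `P_p` with
the triangle switched off. [folklore] -/
theorem bgParam_eq_bgParam (hTS : ∀ j k, eS k ≠ eT j) (hpS : ∀ k, p (eS k) = 0) {q : ι → unitInterval}
    (hqT : ∀ k, q (eT k) = 0) (hpq : ∀ i, (∀ k, i ≠ eT k) → (∀ k, i ≠ eS k) → q i = p i) :
    bgParam q eS = bgParam p eT := by
  funext i
  by_cases hS : ∃ k, i = eS k
  · obtain ⟨k, rfl⟩ := hS
    rw [bgParam_apply_eT, bgParam_apply_of_ne p eT (fun j => hTS j k), hpS]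
  · push Not at hS
    rw [bgParam_apply_of_ne q eS hS]
    by_cases hT : ∃ k, i = eT k
    · obtain ⟨k, rfl⟩ := hT
      rw [bgParam_apply_eT, hqT]
    · push Not at hT
      rw [bgParam_apply_of_ne p eT hT, hpq i hT hS]

/-- **The law of the star → triangle move.** If `ω' ∼ P_q` (star on, triangle off, triangle
parameters in `(0, 1)`) and `U` is an independent uniform variable, then `sMove ω' U ∼ P_p`
(GM13 Prop. 2.2(b): "`S(ω')` has the same law as `ω`"). [cite: GrimmettManolescuAOP2013, Prop 2.2] -/
theorem map_sMove (heT : Function.Injective eT) (heS : Function.Injective eS)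
    (hTS : ∀ j k, eS k ≠ eT j) (hpS : ∀ k, p (eS k) = 0) {q : ι → unitInterval}
    (hqT : ∀ k, q (eT k) = 0) (hqS : ∀ k, (q (eS k) : ℝ) = 1 - p (eT k))
    (hpq : ∀ i, (∀ k, i ≠ eT k) → (∀ k, i ≠ eS k) → q i = p i)
    (hκ : kappa (triParam p eT) = 0) (hpos : ∀ k, 0 < (p (eT k) : ℝ)) (hlt : ∀ k, (p (eT k) : ℝ) < 1) :
    ((prodBernoulli q).prod (volume : Measure unitInterval)).map
        (fun x : Set ι × unitInterval => sMove p eT eS x.1 x.2) = prodBernoulli p := by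
  set r : Fin 3 → ℝ := triParam p eT with hr
  have hp00 : ∀ k, r k ∈ Set.Ioo (0 : ℝ) 1 := fun k => ⟨hpos k, hlt k⟩
  have hp01 : ∀ k, r k ∈ Set.Ico (0 : ℝ) 1 := fun k => ⟨(p (eT k)).2.1, hlt k⟩
  have hp' : ∀ k, r k ∈ Set.Icc (0 : ℝ) 1 := fun k => ⟨(hp01 k).1, (hp01 k).2.le⟩
  have hq' : ∀ k, 1 - r k ∈ Set.Icc (0 : ℝ) 1 := fun k => ⟨by linarith [(hp01 k).2], by linarith [(hp01 k).1]⟩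
  haveI := isProbabilityMeasure_law hp'
  haveI := isProbabilityMeasure_law hq'
  haveI := isProbabilityMeasure_coupling hp01 hκ
  set P0 : Measure (Set ι) := prodBernoulli (bgParam p eT) with hP0
  -- Step 1: superposition for `P_q` over the same background
  have hlaw : law (fun k => ((q (eS k) : unitInterval) : ℝ)) = law (fun k => 1 - r k) := by
    congr 1; funext k; rw [hqS k]; rfl
  have hQ : prodBernoulli q = ((law fun k => 1 - r k).prod P0).map (overlay eS) := by
    rw [← hlaw, hP0, ← bgParam_eq_bgParam hTS hpS hqT hpq]
    exact prodBernoulli_eq_map_overlay heS (bgParam q eS) q (fun k => q (eS k)) (bgParam_apply_eT q eS)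
      (fun _ => rfl) (fun i hi => (bgParam_apply_of_ne q eS hi).symm)
  -- Step 2: pull the overlay through the product with the uniform variable
  have h2 : (((law fun k => 1 - r k).prod P0).map (overlay eS)).prod (volume : Measure unitInterval) =
      (((law fun k => 1 - r k).prod P0).prod (volume : Measure unitInterval)).map (Prod.map (overlay eS) id) := by
    rw [← Measure.map_prod_map _ _ (measurable_overlay eS) measurable_id, Measure.map_id]
  rw [hQ, h2, Measure.map_map measurable_sMove ((measurable_overlay eS).prodMap measurable_id)]
  -- Step 3: on a set of full measure the composite is the overlay of `S`
  set G : ((Fin 3 → Bool) × Set ι) × unitInterval → Set ι :=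
    fun x => overlay eT (sMap r x.1.1 x.2, x.1.2) with hG
  have hbgS : ∀ k, bgParam p eT (eS k) = 0 := fun k => by
    rw [bgParam_apply_of_ne p eT (fun j => hTS j k)]; exact hpS k
  have hae : (fun x : Set ι × unitInterval => sMove p eT eS x.1 x.2) ∘ Prod.map (overlay eS) id
      =ᵐ[((law fun k => 1 - r k).prod P0).prod (volume : Measure unitInterval)] G := by
    have hnull : (((law fun k => 1 - r k).prod P0).prod (volume : Measure unitInterval))
        {x | ∃ k, eS k ∈ x.1.2} = 0 := by
      have hset : {x : ((Fin 3 → Bool) × Set ι) × unitInterval | ∃ k, eS k ∈ x.1.2} =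
          ((Set.univ : Set (Fin 3 → Bool)) ×ˢ {ρ : Set ι | ∃ k, eS k ∈ ρ}) ×ˢ (Set.univ : Set unitInterval) := by
        ext x; simp
      rw [hset, Measure.prod_prod, Measure.prod_prod, prodBernoulli_setOf_exists_mem_eq_zero _ _ hbgS,
        mul_zero, zero_mul]
    refine Filter.eventuallyEq_of_mem (s := {x | ∃ k, eS k ∈ x.1.2}ᶜ) (compl_mem_ae_iff.2 hnull) ?_
    rintro ⟨⟨t, ρ⟩, u⟩ hx
    simp only [Set.mem_compl_iff, Set.mem_setOf_eq, not_exists] at hx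
    simp only [Function.comp_apply, Prod.map_apply, id_eq, hG, sMove]
    rw [readLocal_overlay heS t hx, overlay_diff_range eS t hx]
  rw [Measure.map_congr hae]
  -- Step 4: reorder the factors and push `S` through
  have hGeq : G = (overlay eT ∘ Prod.map (fun y : (Fin 3 → Bool) × unitInterval => sMap r y.1 y.2) id) ∘
      fun x : ((Fin 3 → Bool) × Set ι) × unitInterval => ((x.1.1, x.2), x.1.2) := by
    funext x; rfl
  have hF : Measurable fun y : (Fin 3 → Bool) × unitInterval => sMap r y.1 y.2 :=
    measurable_from_prod_countable_right fun t => measurable_sMap _ t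
  have hψ : Measurable fun x : ((Fin 3 → Bool) × Set ι) × unitInterval => ((x.1.1, x.2), x.1.2) :=
    (measurable_fst.fst.prodMk measurable_snd).prodMk measurable_fst.snd
  rw [hGeq, ← Measure.map_map ((measurable_overlay eT).comp (hF.prodMap measurable_id)) hψ,
    map_prod_prod_swap_right, ← Measure.map_map (measurable_overlay eT) (hF.prodMap measurable_id),
    ← Measure.map_prod_map _ _ hF measurable_id, Measure.map_id]
  -- Step 5: the law of `S`
  have hS : ((law fun k => 1 - r k).prod (volume : Measure unitInterval)).map
      (fun y : (Fin 3 → Bool) × unitInterval => sMap r y.1 y.2) = law r := by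
    have : (fun y : (Fin 3 → Bool) × unitInterval => sMap r y.1 y.2) =
        Prod.fst ∘ fun y : (Fin 3 → Bool) × unitInterval => (sMap r y.1 y.2, y.1) := by
      funext y; rfl
    rw [this, ← Measure.map_map measurable_fst (measurable_sMap_prodMk r), map_sMap_prodMk hp00 hκ,
      map_fst_coupling hp01 hκ]
  rw [hS]
  -- Step 6: superposition for `P_p`
  exact (prodBernoulli_eq_map_overlay heT (bgParam p eT) p (fun k => p (eT k)) (bgParam_apply_eT p eT)
    (fun _ => rfl) (fun i hi => (bgParam_apply_of_ne p eT hi).symm)).symm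

/-! #### The moves are related to their input, surely -/

/-- Off the six coordinates the triangle → star move changes nothing. [cite: arXiv201211672v2, Def 2.9] -/
theorem mem_tMove_iff {ω : Set ι} {u : unitInterval} {i : ι}
    (hT : ∀ k, i ≠ eT k) (hS : ∀ k, i ≠ eS k) : i ∈ tMove p eT eS ω u ↔ i ∈ ω := by
  unfold tMove
  rw [mem_overlay_iff, Set.mem_sdiff, Set.mem_range, not_exists]
  constructor
  · rintro (⟨h, -⟩ | ⟨k, -, hk⟩)
    · exact h
    · exact absurd hk (hS k)
  · intro h
    exact Or.inl ⟨h, fun k hk => hT k hk.symm⟩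

/-- Off the six coordinates the star → triangle move changes nothing. [cite: arXiv201211672v2, Def 2.9] -/
theorem mem_sMove_iff {ω : Set ι} {u : unitInterval} {i : ι}
    (hT : ∀ k, i ≠ eT k) (hS : ∀ k, i ≠ eS k) : i ∈ sMove p eT eS ω u ↔ i ∈ ω := by
  unfold sMove
  rw [mem_overlay_iff, Set.mem_sdiff, Set.mem_range, not_exists]
  constructor
  · rintro (⟨h, -⟩ | ⟨k, -, hk⟩)
    · exact h
    · exact absurd hk (hT k)
  · intro h
    exact Or.inl ⟨h, fun k hk => hS k hk.symm⟩

/-- After the triangle → star move no triangle coordinate is present. [cite: arXiv201211672v2, Def 2.9] -/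
theorem eT_notMem_tMove (hTS : ∀ j k, eS k ≠ eT j) (ω : Set ι) (u : unitInterval) (k : Fin 3) :
    eT k ∉ tMove p eT eS ω u := by
  unfold tMove
  rw [mem_overlay_iff, Set.mem_sdiff, not_or]
  exact ⟨fun h => h.2 ⟨k, rfl⟩, fun ⟨j, _, hj⟩ => hTS k j hj.symm⟩

/-- After the star → triangle move no star coordinate is present. [cite: arXiv201211672v2, Def 2.9] -/
theorem eS_notMem_sMove (hTS : ∀ j k, eS k ≠ eT j) (ω : Set ι) (u : unitInterval) (k : Fin 3) :
    eS k ∉ sMove p eT eS ω u := by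
  unfold sMove
  rw [mem_overlay_iff, Set.mem_sdiff, not_or]
  exact ⟨fun h => h.2 ⟨k, rfl⟩, fun ⟨j, _, hj⟩ => hTS j k hj⟩

/-- The star laid down by the triangle → star move is `T` of the triangle state. [cite: arXiv201211672v2, Def 2.9] -/
theorem readLocal_tMove (heS : Function.Injective eS) {ω : Set ι}
    (hω : ∀ k, eS k ∉ ω) (u : unitInterval) :
    readLocal eS (tMove p eT eS ω u) = tMap (triParam p eT) (readLocal eT ω) u := by
  unfold tMove
  exact readLocal_overlay heS _ (fun k h => hω k h.1)

/-- The triangle laid down by the star → triangle move is `S` of the star state. [cite: arXiv201211672v2, Def 2.9] -/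
theorem readLocal_sMove (heT : Function.Injective eT) {ω : Set ι}
    (hω : ∀ k, eT k ∉ ω) (u : unitInterval) :
    readLocal eT (sMove p eT eS ω u) = sMap (triParam p eT) (readLocal eS ω) u := by
  unfold sMove
  exact readLocal_overlay heT _ (fun k h => hω k h.1)

/-- **The triangle → star move is related to its input, for every value of the uniform
variable**: same states off the hexagon, triangle gone, star compatible (GM13 Prop. 2.2(c)).
[cite: GrimmettManolescuAOP2013, Prop 2.2] -/
theorem isRelated_tMove (heS : Function.Injective eS) (hTS : ∀ j k, eS k ≠ eT j) {ω : Set ι}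
    (hω : ∀ k, eS k ∉ ω) (u : unitInterval) : IsRelated eT eS ω (tMove p eT eS ω u) := by
  classical
  refine ⟨fun i hT hS => (mem_tMove_iff hT hS).symm, hω, eT_notMem_tMove hTS ω u, ?_⟩
  have h := compatible_tMap (triParam p eT) (readLocal eT ω) u
  rw [← readLocal_tMove heS hω u] at h
  convert h using 1 <;> funext k <;> exact congrArg _ (Subsingleton.elim _ _)

/-- **The star → triangle move is related to its input, for every value of the uniform
variable** (GM13 Prop. 2.2(d)). [cite: GrimmettManolescuAOP2013, Prop 2.2] -/
theorem isRelated_sMove (heT : Function.Injective eT) (hTS : ∀ j k, eS k ≠ eT j) {ω : Set ι}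
    (hω : ∀ k, eT k ∉ ω) (u : unitInterval) : IsRelated eT eS (sMove p eT eS ω u) ω := by
  classical
  refine ⟨fun i hT hS => mem_sMove_iff hT hS, eS_notMem_sMove hTS ω u, hω, ?_⟩
  have h := compatible_sMap (triParam p eT) (readLocal eS ω) u
  rw [← readLocal_sMove heT hω u] at h
  convert h using 1 <;> funext k <;> exact congrArg _ (Subsingleton.elim _ _)


/-! #### In a graph: open connections are preserved, surely -/

section Graph

variable {V : Type*} {v : Fin 3 → V} {O : V} {p : Sym2 V → unitInterval}

/-- **The triangle → star move in a graph preserves open connections off the centre, for every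
value of the uniform variable** (GM14 §5.2: "a star–triangle transformation maps an open path of
`G` to an open path of `G'`"; tree: `reachable_iff_of_related`). Hypothesis: `ω` has no edge
at `O`. [cite: GrimmettManolescu2014Isoradial, §5.2] -/
theorem isStarTriangleRelated_tMove (hv : Function.Injective v) (hvO : ∀ k, v k ≠ O) {ω : Set (Sym2 V)}
    (hω : ∀ e ∈ ω, O ∉ e) (u : unitInterval) :
    IsStarTriangleRelated v O ω (tMove p (triEdge v) (starEdge v O) ω u) :=
  isStarTriangleRelated_of_isRelated
    (isRelated_tMove (starEdge_injective hv hvO) (fun j k => starEdge_ne_triEdge hvO j k)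
      (fun _ h => hω _ h (Sym2.mem_mk_left _ _)) u) hω

/-- **The star → triangle move in a graph preserves open connections off the centre, for every
value of the uniform variable.** Hypotheses: `ω'` has no triangle edge, and its only edges at `O`
are star edges. [cite: GrimmettManolescu2014Isoradial, §5.2] -/
theorem isStarTriangleRelated_sMove (hv : Function.Injective v) (hvO : ∀ k, v k ≠ O) {ω' : Set (Sym2 V)}
    (hω' : ∀ k, triEdge v k ∉ ω') (hO : ∀ e ∈ ω', O ∈ e → ∃ k, e = starEdge v O k) (u : unitInterval) :
    IsStarTriangleRelated v O (sMove p (triEdge v) (starEdge v O) ω' u) ω' := by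
  refine isStarTriangleRelated_of_isRelated
    (isRelated_sMove (triEdge_injective hv) (fun j k => starEdge_ne_triEdge hvO j k) hω' u) ?_
  intro e he hOe
  unfold sMove at he
  rcases (mem_overlay_iff _ _ _).1 he with ⟨he', hrange⟩ | ⟨k, -, rfl⟩
  · obtain ⟨k, rfl⟩ := hO e he' hOe
    exact hrange ⟨k, rfl⟩
  · -- a triangle edge does not contain `O`
    revert hOe
    fin_cases k <;> simp [triEdge, fst3, snd3, (hvO _).symm]

/-- Open connections between vertices other than `O` are the same before and after the
triangle → star move, surely. [cite: GrimmettManolescu2014Isoradial, §5.2] -/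
theorem reachable_tMove_iff (hv : Function.Injective v) (hvO : ∀ k, v k ≠ O) {ω : Set (Sym2 V)}
    (hω : ∀ e ∈ ω, O ∉ e) (u : unitInterval) {x y : V} (hx : x ≠ O) (hy : y ≠ O) :
    (SimpleGraph.fromEdgeSet (tMove p (triEdge v) (starEdge v O) ω u)).Reachable x y ↔
      (SimpleGraph.fromEdgeSet ω).Reachable x y :=
  (reachable_iff_of_related hv hvO (isStarTriangleRelated_tMove hv hvO hω u) hx hy).symm

/-- Open connections between vertices other than `O` are the same before and after the
star → triangle move, surely. [cite: GrimmettManolescu2014Isoradial, §5.2] -/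
theorem reachable_sMove_iff (hv : Function.Injective v) (hvO : ∀ k, v k ≠ O) {ω' : Set (Sym2 V)}
    (hω' : ∀ k, triEdge v k ∉ ω') (hO : ∀ e ∈ ω', O ∈ e → ∃ k, e = starEdge v O k) (u : unitInterval)
    {x y : V} (hx : x ≠ O) (hy : y ≠ O) :
    (SimpleGraph.fromEdgeSet (sMove p (triEdge v) (starEdge v O) ω' u)).Reachable x y ↔
      (SimpleGraph.fromEdgeSet ω').Reachable x y :=
  reachable_iff_of_related hv hvO (isStarTriangleRelated_sMove hv hvO hω' hO u) hx hy

end Graph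

/-! #### The distinguished outcome of `S` -/

section Secondary

variable {p : Fin 3 → ℝ}

/-- The first outcome listed for the full star has conditional probability the product of the
odds of the two triangle edges at the corner `2` (`(1-x)(1-y)(1-z) = xy + yz + zx - 2xyz` is not
even needed: `P^△_p{ttf} / P^☆_{1-p}{full} = p₀p₁(1-p₂)/((1-p₀)(1-p₁)(1-p₂))`). This is
Grimmett–Manolescu's "secondary outcome" probability `η_k(n) = p_{π-A}p_{π-B}/(p_A p_B)` (PTRF
159 (2014), proof of Lemma 6.6). [cite: GrimmettManolescu2014Isoradial, §6.2 proof of Lemma 6.6] -/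
theorem sWeight_full_ttf (h2 : p 2 < 1) :
    sWeight p ![true, true, true] ![true, true, false] = odds p 0 * odds p 1 := by
  have h2' : 1 - p 2 ≠ 0 := by linarith
  simp [sWeight, weight, kernelWeight, odds, Fin.prod_univ_three]
  field_simp

/-- **`S` returns the distinguished outcome `(true, true, false)` exactly when the star is full
and the uniform variable is below its conditional probability.** [folklore] -/
theorem sMap_eq_ttf_iff (s : Fin 3 → Bool) (u : ℝ) :
    sMap p s u = ![true, true, false] ↔
      s = ![true, true, true] ∧ u < sWeight p ![true, true, true] ![true, true, false] := by
  obtain ⟨a, b, c, rfl⟩ : ∃ a b c, s = ![a, b, c] := ⟨s 0, s 1, s 2, eq_vec s⟩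
  unfold sMap
  rw [Equiv.symm_apply_eq]
  cases a <;> cases b <;> cases c <;> simp [sList, sDefault, selectList, funext_iff, Fin.forall_fin_succ]
  split_ifs <;> simp_all

end Secondary

end Moves

end StarTriangle

end Literature.Probability.Percolation
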